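import Literature.AnabelianGeometry.SemiGraphs.TemperedCoveringsSubgraphBTemp
import Literature.AnabelianGeometry.SemiGraphs.CoveringGraphTempered

/-!
# Omission of cuspidal edges does not change `B^cov(𝒢)`, `B^temp(𝒢)`, `Π^tp` ([SemiAnbd] §3; [IUTchI] §2 p. 44) — PROOFS

Mochizuki, *Inter-universal Teichmüller theory I*, §2 p. 44 l. 28–30: "the omission of cuspidal
edges clearly does not affect either the tempered or pro-`Σ̂` fundamental groups"
[cite: Mochizuki2012, §2 p.44]; Mochizuki, *Semi-graphs of anabelioids*, Publ. RIMS **42** (2006),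
§3 pp. 36–38 (`B^cov(𝒢) ⊇ B^temp(𝒢)`, Def. 3.5 (ii) tempered coverings, `π₁^temp(𝒢)` with
`B^temp(π₁^temp(𝒢)) ⥲ B^temp(𝒢)`, Prop. 3.6 (ii)) [cite: MochizukiSemiAnbd2006, Def 3.5(ii) p.37].

Proof-only companion of `TemperedCoveringsSubgraph.lean` (abc-iut row W4-30 part 2 — the TEMPERED
half of the [IUTchI] p. 44 merge atom; the profinite half is `CuspOmission.lean`).  For a cusp
omission `ℍ ⊆ 𝔾` (every vertex kept; only edges with exactly one abutting branch dropped):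

* `covRestrict_faithful / _full / _essSurj`, `isEquivalence_covRestrict` — restriction
  `B^cov(𝒢) ⥤ B^cov(𝒢_ℍ)` is an equivalence of categories;
* `IsTempered.covRestrict` (ANY sub-semi-graph: restriction refines connected components and keeps
  the splitting finite coverings) and `isTempered_of_covRestrict` (cusp omission: a point over an
  omitted cusp `e ⊸ v` is adjacent to its glued image in `S_v`, so components and splittings are
  read on `S|_ℍ` through `retractPoint`) — temperedness is unchanged;
* `btempRestrict`-free formulation: `isEquivalence_btempRestrict` for the induced functor
  `B^temp(𝒢) ⥤ B^temp(𝒢_ℍ)` (`ObjectProperty.lift` of `covRestrict`), and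
  **`temperedPiChartOfCuspOmission : TemperedPiChart 𝒢 → TemperedPiChart (𝒢.restrict H)` with the
  SAME underlying topological group** — "`Π^tp` unchanged by cusp omission".

Nothing here takes a side on [IUTchIII] Cor. 3.12.
-/

namespace Literature.AnabelianGeometry.SemiGraphs

namespace ProfiniteSemiGraph

open CategoryTheory

universe u

variable {𝒢 : ProfiniteSemiGraph.{u}} {H : 𝒢.graph.Subgraph}

/-! ### Morphisms of `B^cov(𝒢)` are determined over a cusp by their vertex components -/

/-- The edge component of a morphism of `B^cov(𝒢)` over the edge of a branch `b` abutting to `v` is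
forced by the vertex component at `v`: `f_e = glue_T⁻¹ ∘ b^*(f_v) ∘ glue_S`.
[cite: MochizukiSemiAnbd2006, §3 p.36] -/
theorem CovObj.fE_edgeOf_eq {S T : CovObj 𝒢} (f : S ⟶ T) (b : 𝒢.graph.Branch)
    (v : 𝒢.graph.Vertex) (h : 𝒢.graph.abuts b = some v) :
    f.fE (𝒢.graph.edgeOf b) =
      (S.glue b v h).hom ≫ (BTemp.res (𝒢.brHom b v h)).map (f.fV v) ≫ (T.glue b v h).inv := by
  rw [← Category.assoc, Iso.eq_comp_inv]
  exact f.comm b v h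

/-! ### `B^cov(𝒢) ⥤ B^cov(𝒢_ℍ)` is an equivalence for a cusp omission -/

/-- For a cusp omission `ℍ`, restriction `B^cov(𝒢) ⥤ B^cov(𝒢_ℍ)` is faithful.
[cite: Mochizuki2012, §2 p.44] -/
theorem covRestrict_faithful (hH : H.IsCuspOmission) : (𝒢.covRestrict H).Faithful :=
  ⟨fun {S T} f g hfg => by
    have hV : ∀ v, f.fV v = g.fV v := fun v =>
      congrArg (fun k : (𝒢.covRestrict H).obj S ⟶ (𝒢.covRestrict H).obj T => k.fV (hH.vtx v)) hfg
    apply CovHom.ext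
    · exact funext hV
    · funext e
      by_cases he : e ∈ H.edges
      · exact congrArg (fun k : (𝒢.covRestrict H).obj S ⟶ (𝒢.covRestrict H).obj T =>
          k.fE ⟨e, he⟩) hfg
      · obtain ⟨⟨b, v⟩, hbe, hbv⟩ := hH.exists_cusp e he
        subst hbe
        rw [CovObj.fE_edgeOf_eq f b v hbv, CovObj.fE_edgeOf_eq g b v hbv, hV v]⟩

open Classical in
/-- For a cusp omission `ℍ`, restriction `B^cov(𝒢) ⥤ B^cov(𝒢_ℍ)` is full (`CovObj.homOfRestrict`).
[cite: Mochizuki2012, §2 p.44] -/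
theorem covRestrict_full (hH : H.IsCuspOmission) : (𝒢.covRestrict H).Full :=
  ⟨fun {S T} g => ⟨CovObj.homOfRestrict hH g, by
    apply CovHom.ext
    · funext w
      rfl
    · funext e
      show dite _ _ _ = _
      exact dif_pos e.2⟩⟩

/-- For a cusp omission `ℍ`, restriction `B^cov(𝒢) ⥤ B^cov(𝒢_ℍ)` is essentially surjective
(`CovObj.extendAlongCusps`). [cite: Mochizuki2012, §2 p.44] -/
theorem covRestrict_essSurj (hH : H.IsCuspOmission) : (𝒢.covRestrict H).EssSurj :=
  ⟨fun A' => ⟨CovObj.extendAlongCusps hH A', ⟨CovObj.extendAlongCuspsIso hH A'⟩⟩⟩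

/-- **Omission of cuspidal edges does not change `B^cov(𝒢)`**: for a cusp omission `ℍ ⊆ 𝔾` the
restriction functor `B^cov(𝒢) ⥤ B^cov(𝒢_ℍ)` is an equivalence of categories.
[cite: Mochizuki2012, §2 p.44] -/
theorem isEquivalence_covRestrict (hH : H.IsCuspOmission) : (𝒢.covRestrict H).IsEquivalence :=
  { faithful := covRestrict_faithful hH
    full := covRestrict_full hH
    essSurj := covRestrict_essSurj hH }

namespace CovObj

/-! ### Temperedness extends over the omitted cusps -/

/-- Transport of a point along a proof of `e = e` is the identity. [cite: MochizukiSemiAnbd2006, Def 3.5(ii) p.37] -/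
theorem castPoint_eq (S : CovObj 𝒢) {e : 𝒢.graph.Edge} (p : e = e) (x : (S.SE e).obj.V) :
    castPoint S p x = x := rfl

/-- The gluing is `Π_e`-equivariant on points: `glue (g · y) = b_*(g) · glue y`.
[cite: MochizukiSemiAnbd2006, §3 p.36] -/
theorem glue_ρ_apply (S : CovObj 𝒢) (b : 𝒢.graph.Branch) (v : 𝒢.graph.Vertex)
    (h : 𝒢.graph.abuts b = some v) (g : 𝒢.Ge (𝒢.graph.edgeOf b))
    (y : (S.SE (𝒢.graph.edgeOf b)).obj.V) :
    (S.glue b v h).hom.hom.hom ((S.SE _).obj.ρ g y) =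
      (S.SV v).obj.ρ (𝒢.brHom b v h g) ((S.glue b v h).hom.hom.hom y) :=
  ConcreteCategory.congr_hom ((S.glue b v h).hom.hom.comm g) y

/-- The gluing is injective on points (it is an isomorphism) — private copy of the tree's
`CovObj.glue_injective` (`UniversalCoveringOverRigid.lean`), kept local to avoid that import.
[cite: MochizukiSemiAnbd2006, §3 p.36] -/
private theorem glue_injective' (S : CovObj 𝒢) (b : 𝒢.graph.Branch) (v : 𝒢.graph.Vertex)
    (h : 𝒢.graph.abuts b = some v) : Function.Injective (S.glue b v h).hom.hom.hom := by
  have hy : ∀ y, (S.glue b v h).inv.hom.hom ((S.glue b v h).hom.hom.hom y) = y := fun y =>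
    ConcreteCategory.congr_hom (congrArg (fun φ => φ.hom) (S.glue b v h).hom_inv_id) y
  exact Function.LeftInverse.injective hy

/-- For a cusp omission: adjacency in `S` retracts to "same component" in `S|_ℍ` — a point over an
omitted cusp `e ⊸ v` and its `Π_e`-translates retract to `Π_v`-translates of its glued image; the
gluing adjacency along the (unique) abutting branch of `e` retracts to an equality.
[cite: Mochizuki2012, §2 p.44] -/
theorem sameComponent_retractPoint_of_adj (hH : H.IsCuspOmission) (S : CovObj 𝒢) {p q : S.Point}
    (hpq : S.Adj p q) :
    ((𝒢.covRestrict H).obj S).SameComponent (retractPoint hH S p) (retractPoint hH S q) := by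
  cases hpq with
  | vertex v g x =>
    exact Relation.EqvGen.rel _ _ (Adj.vertex (S := (𝒢.covRestrict H).obj S) (hH.vtx v) g x)
  | edge e g x =>
    by_cases he : e ∈ H.edges
    · rw [retractPoint_inr_of_mem hH S he, retractPoint_inr_of_mem hH S he]
      exact Relation.EqvGen.rel _ _ (Adj.edge (S := (𝒢.covRestrict H).obj S) ⟨e, he⟩ g x)
    · rw [retractPoint_inr_of_not_mem hH S he, retractPoint_inr_of_not_mem hH S he]
      -- over a variable presentation of the cusp
      generalize hH.cuspBranch e he = c
      obtain ⟨b, w, hbe, hbw⟩ := c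
      subst hbe
      dsimp only
      rw [castPoint_eq, castPoint_eq, glue_ρ_apply]
      exact Relation.EqvGen.rel _ _
        (Adj.vertex (S := (𝒢.covRestrict H).obj S) (hH.vtx w) (𝒢.brHom b w hbw g) _)
  | glue b v h x =>
    by_cases he : 𝒢.graph.edgeOf b ∈ H.edges
    · rw [retractPoint_inr_of_mem hH S he, retractPoint_inl]
      exact Relation.EqvGen.rel _ _ (Adj.glue (S := (𝒢.covRestrict H).obj S) ⟨b, he⟩ (hH.vtx v)
        ((H.abuts_mk_eq_some_iff he _).mpr h) x)
    · rw [retractPoint_inr_of_not_mem hH S he, retractPoint_inl]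
      -- `b` IS the verticial branch of its (omitted) edge
      obtain ⟨hb, hv⟩ := hH.eq_cusp (he := he) rfl h
      have key : ∀ (c : 𝒢.graph.VerticialBranch (𝒢.graph.edgeOf b)), b = c.branch → v = c.vertex →
          (Sum.inl ⟨hH.vtx c.vertex, (S.glue c.branch c.vertex c.abuts_branch).hom.hom.hom
            (castPoint S c.edgeOf_branch.symm x)⟩ : ((𝒢.covRestrict H).obj S).Point) =
            Sum.inl ⟨hH.vtx v, (S.glue b v h).hom.hom.hom x⟩ := by
        rintro ⟨b₀, v₀, hb₀, hv₀⟩ rfl rfl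
        rfl
      rw [key (hH.cuspBranch _ he) hb hv]
      exact Relation.EqvGen.refl _

/-- Connected components of `S` retract into connected components of `S|_ℍ`.
[cite: Mochizuki2012, §2 p.44] -/
theorem sameComponent_retractPoint (hH : H.IsCuspOmission) (S : CovObj 𝒢) {p q : S.Point}
    (hpq : S.SameComponent p q) :
    ((𝒢.covRestrict H).obj S).SameComponent (retractPoint hH S p) (retractPoint hH S q) := by
  induction hpq with
  | rel _ _ h => exact sameComponent_retractPoint_of_adj hH S h
  | refl _ => exact Relation.EqvGen.refl _
  | symm _ _ _ ih => exact Relation.EqvGen.symm _ _ ih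
  | trans _ _ _ _ _ ih₁ ih₂ => exact Relation.EqvGen.trans _ _ _ ih₁ ih₂

/-- Splitting at a point of `S` follows from splitting (for the restricted coverings) at its
retraction: over an omitted cusp `e ⊸ v`, a `g ∈ Π_e` fixing a point `x` of `F_e` has `b_*(g)`
fixing `glue x ∈ F_v`, hence fixing `glue s ∈ S_v`, i.e. `g` fixes `s` (`glue` injective).
[cite: Mochizuki2012, §2 p.44] -/
theorem splitsAt_of_retractPoint (hH : H.IsCuspOmission) {F S : CovObj 𝒢} (q : S.Point)
    (h : ((𝒢.covRestrict H).obj F).SplitsAt ((𝒢.covRestrict H).obj S) (retractPoint hH S q)) :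
    F.SplitsAt S q := by
  rcases q with ⟨v, s⟩ | ⟨e, s⟩
  · exact h
  · by_cases he : e ∈ H.edges
    · rw [retractPoint_inr_of_mem hH S he] at h
      exact h
    · rw [retractPoint_inr_of_not_mem hH S he] at h
      revert h
      generalize hH.cuspBranch e he = c
      obtain ⟨b, w, hbe, hbw⟩ := c
      subst hbe
      dsimp only
      rw [castPoint_eq]
      intro h x g hgx
      -- `b_*(g)` fixes the glued image of `x`, hence the glued image of `s`
      have hx : (F.SV w).obj.ρ (𝒢.brHom b w hbw g) ((F.glue b w hbw).hom.hom.hom x) =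
          (F.glue b w hbw).hom.hom.hom x := by
        rw [← glue_ρ_apply, hgx]
      have hs : (S.SV w).obj.ρ (𝒢.brHom b w hbw g) ((S.glue b w hbw).hom.hom.hom s) =
          (S.glue b w hbw).hom.hom.hom s := h _ _ hx
      rw [← glue_ρ_apply] at hs
      exact glue_injective' S b w hbw hs

/-- Splitting at a point is inherited along a morphism of the splitting coverings: if `F₂` splits
`S` at `q` and `F₁ → F₂`, then `F₁` splits `S` at `q` (stabilisers grow along equivariant maps).
[cite: MochizukiSemiAnbd2006, Def 3.5(ii) p.37] -/
theorem SplitsAt.of_hom {F₁ F₂ S : CovObj 𝒢} (f : F₁ ⟶ F₂) (q : S.Point)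
    (h : F₂.SplitsAt S q) : F₁.SplitsAt S q := by
  rcases q with ⟨v, s⟩ | ⟨e, s⟩
  · intro x g hgx
    refine h ((f.fV v).hom.hom x) g ?_
    have hf : (f.fV v).hom.hom ((F₁.SV v).obj.ρ g x) = (F₂.SV v).obj.ρ g ((f.fV v).hom.hom x) :=
      ConcreteCategory.congr_hom ((f.fV v).hom.comm g) x
    rw [← hf, hgx]
  · intro x g hgx
    refine h ((f.fE e).hom.hom x) g ?_
    have hf : (f.fE e).hom.hom ((F₁.SE e).obj.ρ g x) = (F₂.SE e).obj.ρ g ((f.fE e).hom.hom x) :=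
      ConcreteCategory.congr_hom ((f.fE e).hom.comm g) x
    rw [← hf, hgx]

/-- The extension of a finite object along a cusp omission is finite (over a cusp the new fibre is
a vertex fibre). [cite: Mochizuki2012, §2 p.44] -/
theorem IsFinite.extendAlongCusps (hH : H.IsCuspOmission) {F' : CovObj (𝒢.restrict H)}
    (h : F'.IsFinite) : (extendAlongCusps hH F').IsFinite := by
  refine ⟨fun v => h.finite_V (hH.vtx v), fun e => ?_⟩
  change Finite (extendSE hH F' e).obj.V
  by_cases he : e ∈ H.edges
  · rw [extendSE_of_mem hH F' he]
    exact h.finite_E ⟨e, he⟩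
  · rw [extendSE_of_not_mem hH F' he]
    generalize hH.cuspBranch e he = c
    obtain ⟨b, w, hbe, hbw⟩ := c
    subst hbe
    exact h.finite_V (hH.vtx w)

/-- The extension of an object with nonempty fibres along a cusp omission has nonempty fibres.
[cite: Mochizuki2012, §2 p.44] -/
theorem HasNonemptyFibres.extendAlongCusps (hH : H.IsCuspOmission) {F' : CovObj (𝒢.restrict H)}
    (h : F'.HasNonemptyFibres) : (extendAlongCusps hH F').HasNonemptyFibres := by
  refine ⟨fun v => h.nonempty_V (hH.vtx v), fun e => ?_⟩
  change Nonempty (extendSE hH F' e).obj.V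
  by_cases he : e ∈ H.edges
  · rw [extendSE_of_mem hH F' he]
    exact h.nonempty_E ⟨e, he⟩
  · rw [extendSE_of_not_mem hH F' he]
    generalize hH.cuspBranch e he = c
    obtain ⟨b, w, hbe, hbw⟩ := c
    subst hbe
    exact h.nonempty_V (hH.vtx w)

/-- **Temperedness extends over the omitted cusps**: for a cusp omission `ℍ`, an object `S` of
`B^cov(𝒢)` whose restriction `S|_ℍ` is tempered is tempered (the splitting finite coverings of
`𝒢_ℍ` extend along the cusps, `CovObj.extendAlongCusps`; components and splittings are read on
`S|_ℍ` through `retractPoint`). [cite: Mochizuki2012, §2 p.44] -/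
theorem isTempered_of_covRestrict (hH : H.IsCuspOmission) (S : CovObj 𝒢)
    (hS : ((𝒢.covRestrict H).obj S).IsTempered) : S.IsTempered := by
  intro p
  obtain ⟨F', hF', hF'ne, hsplit⟩ := hS (retractPoint hH S p)
  refine ⟨CovObj.extendAlongCusps hH F', hF'.extendAlongCusps hH, hF'ne.extendAlongCusps hH,
    fun q hpq => splitsAt_of_retractPoint hH q ?_⟩
  exact SplitsAt.of_hom (extendAlongCuspsIso hH F').hom _
    (hsplit _ (sameComponent_retractPoint hH S hpq))

/-- **Omission of cuspidal edges does not change temperedness**: for a cusp omission `ℍ`, `S` is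
tempered iff `S|_ℍ` is. [cite: Mochizuki2012, §2 p.44] -/
theorem isTempered_covRestrict_iff (hH : H.IsCuspOmission) (S : CovObj 𝒢) :
    ((𝒢.covRestrict H).obj S).IsTempered ↔ S.IsTempered :=
  ⟨isTempered_of_covRestrict hH S, fun h => h.covRestrict H⟩

end CovObj

/-! ### `B^temp(𝒢) ⥤ B^temp(𝒢_ℍ)` is an equivalence; `Π^tp` is unchanged -/

/-- For a cusp omission `ℍ`, `B^temp(𝒢) ⥤ B^temp(𝒢_ℍ)` is faithful. [cite: Mochizuki2012, §2 p.44] -/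
theorem btempRestrict_faithful (hH : H.IsCuspOmission) : (𝒢.btempRestrict H).Faithful := by
  haveI := covRestrict_faithful hH
  exact inferInstanceAs (ObjectProperty.lift _ (ObjectProperty.ι _ ⋙ 𝒢.covRestrict H) _).Faithful

/-- For a cusp omission `ℍ`, `B^temp(𝒢) ⥤ B^temp(𝒢_ℍ)` is full. [cite: Mochizuki2012, §2 p.44] -/
theorem btempRestrict_full (hH : H.IsCuspOmission) : (𝒢.btempRestrict H).Full := by
  haveI := covRestrict_full hH
  exact inferInstanceAs (ObjectProperty.lift _ (ObjectProperty.ι _ ⋙ 𝒢.covRestrict H) _).Full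

/-- For a cusp omission `ℍ`, `B^temp(𝒢) ⥤ B^temp(𝒢_ℍ)` is essentially surjective: a tempered
covering of `𝒢_ℍ` extends along the cusps to a TEMPERED covering of `𝒢`
(`CovObj.isTempered_of_covRestrict`). [cite: Mochizuki2012, §2 p.44] -/
theorem btempRestrict_essSurj (hH : H.IsCuspOmission) : (𝒢.btempRestrict H).EssSurj :=
  ⟨fun A' =>
    ⟨⟨CovObj.extendAlongCusps hH A'.obj, CovObj.isTempered_of_covRestrict hH _
        (CovObj.isTempered_of_iso (CovObj.extendAlongCuspsIso hH A'.obj) A'.property)⟩,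
      ⟨(ObjectProperty.fullyFaithfulι _).preimageIso (CovObj.extendAlongCuspsIso hH A'.obj)⟩⟩⟩

/-- **Omission of cuspidal edges does not change `B^temp(𝒢)`**: for a cusp omission `ℍ ⊆ 𝔾`,
`B^temp(𝒢) ⥤ B^temp(𝒢_ℍ)` is an equivalence of categories. [cite: Mochizuki2012, §2 p.44] -/
theorem isEquivalence_btempRestrict (hH : H.IsCuspOmission) : (𝒢.btempRestrict H).IsEquivalence :=
  { faithful := btempRestrict_faithful hH
    full := btempRestrict_full hH
    essSurj := btempRestrict_essSurj hH }

/-- `B^temp(𝒢) ≌ B^temp(𝒢_ℍ)` for a cusp omission `ℍ`. [cite: Mochizuki2012, §2 p.44] -/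
theorem nonempty_btempCat_equivalence (hH : H.IsCuspOmission) :
    Nonempty (BTempCat 𝒢 ≌ BTempCat (𝒢.restrict H)) := by
  haveI := isEquivalence_btempRestrict hH
  exact ⟨(𝒢.btempRestrict H).asEquivalence⟩

/-- **`Π^tp` is unchanged by cusp omission** ([IUTchI] §2 p. 44 l. 28–30): for a cusp omission
`ℍ ⊆ 𝔾` and a tempered fundamental group `Π = π₁^temp(𝒢)` (a chart `B^temp(𝒢) ≌ B^temp(Π)`),
the SAME tempered group `Π` is a tempered fundamental group of `𝒢_ℍ`: `B^temp(𝒢_ℍ) ≌ B^temp(Π)`.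
[cite: Mochizuki2012, §2 p.44] -/
theorem nonempty_btempCat_restrict_equivalence_btemp (hH : H.IsCuspOmission)
    (c : TemperedPiChart 𝒢) : Nonempty (BTempCat (𝒢.restrict H) ≌ BTemp c.G) := by
  obtain ⟨e⟩ := nonempty_btempCat_equivalence hH
  exact ⟨e.symm.trans c.equiv⟩

/-- **`Π^tp` is unchanged by cusp omission**, chart form: every tempered fundamental group of `𝒢`
is (the underlying group of) a tempered fundamental group of `𝒢_ℍ`
(`TemperedPiChart.transport` along `B^temp(𝒢_ℍ) ≌ B^temp(𝒢)`). [cite: Mochizuki2012, §2 p.44] -/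
theorem exists_temperedPiChart_restrict_G_eq (hH : H.IsCuspOmission) (c : TemperedPiChart 𝒢) :
    ∃ c' : TemperedPiChart (𝒢.restrict H), c'.G = c.G := by
  obtain ⟨e⟩ := nonempty_btempCat_equivalence hH
  exact ⟨c.transport e.symm, rfl⟩

end ProfiniteSemiGraph

end Literature.AnabelianGeometry.SemiGraphs
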